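import Summits.ResolutionOfSingularities.ResolutionOfSingularities.Theorems.EquisingularLiftEquisingularLiftNatHyperplaneLetterThroughSection
import HarnessLib

/-!
# [OURS · L1 W4.5(b) · EL♮(3) · D5 HOPEN, (IN-1) JOINT BIRTH, helper for (B7)] THE LETTER MODELS AS ONE FUNCTION `𝓛 : k[x] → 𝒪-ideals`
# — ★ `KeyForm.exists_letterModels`: `Classical.choose`-packaging of ✓ `LinearLetter.exists_letter_model_le_ker` over a list of letters

res-type-027 g21 (free hand after (B3)(B4)(B5) ✓; offer (a) of STATUS 2026-08-28T22:59Z for res-L1-w45b-stub-4 g12's (B7) assembly of `hBirth` of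
✓ `TCPlus.opening_pointPhase` / ✓ `TCPlus.hopen_supplier_of₂`; NOT a brick of the SIG file — a no-risk helper the assembler may consume or ignore).
Crux `EquisingularLiftNatThree` = stmt-ResolutionOfSingularities-20148 (parent stmt-…-20038), route `EquisingularLift`, line `sections`. OURS; NOT a
statement of any manuscript ([Hironaka2017] is a candidate under adjudication, nothing of it is asserted); AI-written, weaker than expert review.
No `sorry`, no definition, no instance; standard axioms. `--supports stmt-ResolutionOfSingularities-20148 --as helper`.

WHAT. `hBirth` asks for ONE function `𝓛 : k[x₀,…,x_{r+1}] → (ideal sheaves on ℙ_O)` carrying, for every letter `ℓ` of a LIST (`ℓh :: ℓj :: ℓs`), the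
five `LetterDatum` clauses of the model `𝓛 ℓ` at the initial stage and `𝓛 ℓ ≤ ker s`; bricks (B5)/(B6) moreover consume the part-3 currency of
`𝓛 ℓh`, `𝓛 ℓj` (`𝓛 ℓ = ker (Proj f_ℓ)`, `ker f_ℓ = (ℓ̃)`, `θ ℓ̃ = ℓ`, `f_ℓ` fixing constants with section `x_{j.succAbove}`). This file packages
res-type-027 g19's per-letter ★ `LinearLetter.exists_letter_model_le_ker` into exactly that: `exists_letterModels` — given the section `s` through `g x₀`
and a list `L` of non-zero linear forms through `x₀` off `H`, there is `𝓛` with, for every `ℓ ∈ L`, the part-3 data AND (grouped as in `hBirth`) the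
five clauses ∧ `𝓛 ℓ ≤ ker s`. Pure logic (`choose` + `dite`) over the cited theorem.
-/

set_option linter.dupNamespace false -- mandated namespace `Summit.<Summit>.<Problem>` of this single-conjunct summit
set_option linter.overlappingInstances false -- signatures carry `[IsDomain O] [IsDiscreteValuationRing O]`

noncomputable section

open CategoryTheory AlgebraicGeometry TopologicalSpace IsLocalRing
open MvPolynomial HomogeneousLocalization
open Literature.AlgebraicGeometry.Resolution
open AlgebraicGeometry.Scheme.IdealSheafData

namespace Summit.ResolutionOfSingularities.ResolutionOfSingularities.Cruxes.EquisingularLiftNat.Sections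

namespace KeyForm

/-- ★ **THE LETTER MODELS AS ONE FUNCTION.** In the EL♮ ambient `ℙ^{r+1}_O → Spec O` (`O` a DVR, `θ : O ↠ k`, `φ = map θ` graded, special fibre
`g = Proj φ`), let `s` be a section through `g x₀` and `L` a list of linear forms `ℓ ≠ 0` with `x₀ ∈ V₊(ℓ)` and `H ⊄ V₊(ℓ)`. Then there is ONE function
`𝓛 : k[x] → (ideal sheaves on ℙ_O)` such that for every `ℓ ∈ L`: `𝓛 ℓ = ker (Proj f_ℓ)` for a graded substitution `f_ℓ` fixing constants, with section
`x_{j₁.succAbove}`, `ker f_ℓ = (Σ cᵢ xᵢ)`, `θ(Σ cᵢ xᵢ) = ℓ`; and — grouped as in `hBirth` — the five `LetterDatum` clauses of `𝓛 ℓ` (trace `𝓘⟨closure V₊(ℓ)⟩`,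
principal stalks, regular, off the generic point of `Y`, flat over `O`) ∧ `𝓛 ℓ ≤ ker s`. (`choose` over ✓ `LinearLetter.exists_letter_model_le_ker`,
`⊥` off the list's hypotheses.) [OURS · L1 W4.5b · D5 HOPEN (IN-1), helper for (B7)] -/
theorem exists_letterModels (O : Type) [CommRing O] [IsDomain O] [IsDiscreteValuationRing O] {k : Type} [Field k] (θ : O →+* k)
    (hθ : Function.Surjective θ) {r : ℕ} :
    letI := MvPolynomial.gradedAlgebra (σ := Fin (r + 1 + 1)) (R := O)
    letI := MvPolynomial.gradedAlgebra (σ := Fin (r + 1 + 1)) (R := k)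
    letI := MvPolynomial.gradedAlgebra (σ := Fin (r + 1)) (R := O)
    ∀ (φ : (homogeneousSubmodule (Fin (r + 1 + 1)) O) →+*ᵍ (homogeneousSubmodule (Fin (r + 1 + 1)) k))
    (hφ' : HomogeneousIdeal.irrelevant (homogeneousSubmodule (Fin (r + 1 + 1)) k) ≤
      (HomogeneousIdeal.irrelevant (homogeneousSubmodule (Fin (r + 1 + 1)) O)).map φ)
    (_hφ : ∀ q, φ q = MvPolynomial.map θ q)
    (s : Spec (.of O) ⟶ Proj (homogeneousSubmodule (Fin (r + 1 + 1)) O))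
    (_hs : s ≫ (Proj.toSpecZero (homogeneousSubmodule (Fin (r + 1 + 1)) O) ≫
      Spec.map (CommRingCat.ofHom (algebraMap O ((homogeneousSubmodule (Fin (r + 1 + 1)) O) 0)))) = 𝟙 _)
    (x₀ : Proj (homogeneousSubmodule (Fin (r + 1 + 1)) k)) (_hsx : s (IsLocalRing.closedPoint O) = Proj.map φ hφ' x₀)
    {H : Scheme.{0}} [IsIntegral H] (ι : H ⟶ Proj (homogeneousSubmodule (Fin (r + 1 + 1)) k)) [IsClosedImmersion ι]
    (L : List (MvPolynomial (Fin (r + 1 + 1)) k))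
    (_hL : ∀ ℓ ∈ L, ℓ.IsHomogeneous 1 ∧ ℓ ≠ 0 ∧ ℓ ∈ x₀.asHomogeneousIdeal ∧
      ¬ Set.range ι ⊆ {y : Proj (homogeneousSubmodule (Fin (r + 1 + 1)) k) | ℓ ∈ y.asHomogeneousIdeal}),
    ∃ 𝓛 : MvPolynomial (Fin (r + 1 + 1)) k → (Proj (homogeneousSubmodule (Fin (r + 1 + 1)) O)).IdealSheafData,
      ∀ ℓ ∈ L, ∃ (c : Fin (r + 1 + 1) → O) (j₁ : Fin (r + 1 + 1))
        (fO : (homogeneousSubmodule (Fin (r + 1 + 1)) O) →+*ᵍ (homogeneousSubmodule (Fin (r + 1)) O))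
        (hfO' : HomogeneousIdeal.irrelevant (homogeneousSubmodule (Fin (r + 1)) O) ≤
          (HomogeneousIdeal.irrelevant (homogeneousSubmodule (Fin (r + 1 + 1)) O)).map fO),
        𝓛 ℓ = (Proj.map fO hfO').ker ∧
        MvPolynomial.map θ (∑ i, C (c i) * X i) = ℓ ∧ (∑ i, C (c i) * X i : MvPolynomial (Fin (r + 1 + 1)) O).IsHomogeneous 1 ∧
        (∀ b : O, fO (C b) = C b) ∧ (∀ j : Fin (r + 1), fO (X (Fin.succAbove j₁ j)) = X j) ∧
        RingHom.ker fO = Ideal.span {∑ i, C (c i) * X i} ∧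
        (((𝓛 ℓ).comap (Proj.map φ hφ') =
            vanishingIdeal (⟨closure {y : Proj (homogeneousSubmodule (Fin (r + 1 + 1)) k) | ℓ ∈ y.asHomogeneousIdeal},
              isClosed_closure⟩ : Closeds (Proj (homogeneousSubmodule (Fin (r + 1 + 1)) k)))) ∧
          (∀ z : Proj (homogeneousSubmodule (Fin (r + 1 + 1)) O), (stalkIdeal (𝓛 ℓ) z).IsPrincipal) ∧
          Scheme.IsRegular (𝓛 ℓ).subscheme ∧
          (𝟙 (Proj (homogeneousSubmodule (Fin (r + 1 + 1)) O)) : _ ⟶ _) '' ((𝓛 ℓ).support : Set (Proj (homogeneousSubmodule (Fin (r + 1 + 1)) O))) ⊆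
            {x | ¬ IsGenericPoint x (Set.range (ι ≫ Proj.map φ hφ'))} ∧
          Flat ((𝓛 ℓ).subschemeι ≫ 𝟙 _ ≫ (Proj.toSpecZero (homogeneousSubmodule (Fin (r + 1 + 1)) O) ≫
            Spec.map (CommRingCat.ofHom (algebraMap O ((homogeneousSubmodule (Fin (r + 1 + 1)) O) 0)))))) ∧
        𝓛 ℓ ≤ s.ker := by
  letI := MvPolynomial.gradedAlgebra (σ := Fin (r + 1 + 1)) (R := O)
  letI := MvPolynomial.gradedAlgebra (σ := Fin (r + 1 + 1)) (R := k)
  letI := MvPolynomial.gradedAlgebra (σ := Fin (r + 1)) (R := O)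
  intro φ hφ' hφ s hs x₀ hsx H _ ι _ L hL
  classical
  -- the per-letter theorem, under the list's hypotheses `P ℓ`
  have key : ∀ ℓ : MvPolynomial (Fin (r + 1 + 1)) k,
      (ℓ.IsHomogeneous 1 ∧ ℓ ≠ 0 ∧ ℓ ∈ x₀.asHomogeneousIdeal ∧
        ¬ Set.range ι ⊆ {y : Proj (homogeneousSubmodule (Fin (r + 1 + 1)) k) | ℓ ∈ y.asHomogeneousIdeal}) →
      ∃ (c : Fin (r + 1 + 1) → O) (a : Fin (r + 1 + 1))
        (fO : (homogeneousSubmodule (Fin (r + 1 + 1)) O) →+*ᵍ (homogeneousSubmodule (Fin (r + 1)) O))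
        (hfO' : HomogeneousIdeal.irrelevant (homogeneousSubmodule (Fin (r + 1)) O) ≤
          (HomogeneousIdeal.irrelevant (homogeneousSubmodule (Fin (r + 1 + 1)) O)).map fO),
        MvPolynomial.map θ (∑ i, C (c i) * X i) = ℓ ∧
        (∀ b : O, fO (C b) = C b) ∧ (∀ j : Fin (r + 1), fO (X (Fin.succAbove a j)) = X j) ∧
        RingHom.ker fO = Ideal.span {∑ i, C (c i) * X i} ∧
        (Proj.map fO hfO').ker.comap (Proj.map φ hφ') =
            vanishingIdeal (⟨closure {y : Proj (homogeneousSubmodule (Fin (r + 1 + 1)) k) | ℓ ∈ y.asHomogeneousIdeal},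
              isClosed_closure⟩ : Closeds (Proj (homogeneousSubmodule (Fin (r + 1 + 1)) k))) ∧
        (∀ z : Proj (homogeneousSubmodule (Fin (r + 1 + 1)) O), (stalkIdeal (Proj.map fO hfO').ker z).IsPrincipal) ∧
        Scheme.IsRegular (Proj.map fO hfO').ker.subscheme ∧
        (𝟙 (Proj (homogeneousSubmodule (Fin (r + 1 + 1)) O)) : _ ⟶ _) ''
            ((Proj.map fO hfO').ker.support : Set (Proj (homogeneousSubmodule (Fin (r + 1 + 1)) O))) ⊆
          {x | ¬ IsGenericPoint x (Set.range (ι ≫ Proj.map φ hφ'))} ∧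
        Flat ((Proj.map fO hfO').ker.subschemeι ≫ 𝟙 _ ≫ (Proj.toSpecZero (homogeneousSubmodule (Fin (r + 1 + 1)) O) ≫
          Spec.map (CommRingCat.ofHom (algebraMap O ((homogeneousSubmodule (Fin (r + 1 + 1)) O) 0))))) ∧
        (Proj.map fO hfO').ker ≤ s.ker :=
    fun ℓ h => LinearLetter.exists_letter_model_le_ker θ hθ φ hφ hφ' s hs x₀ hsx ℓ h.1 h.2.1 h.2.2.1 ι h.2.2.2
  choose c j₁ fO hfO' hspec using key
  refine ⟨fun ℓ => if h : (ℓ.IsHomogeneous 1 ∧ ℓ ≠ 0 ∧ ℓ ∈ x₀.asHomogeneousIdeal ∧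
      ¬ Set.range ι ⊆ {y : Proj (homogeneousSubmodule (Fin (r + 1 + 1)) k) | ℓ ∈ y.asHomogeneousIdeal}) then
        (Proj.map (fO ℓ h) (hfO' ℓ h)).ker else ⊥, fun ℓ hℓ => ?_⟩
  have h := hL ℓ hℓ
  obtain ⟨hmap, hC, he, hker, h1, h2, h3, h4, h5, hle⟩ := hspec ℓ h
  have hdef : (if h' : (ℓ.IsHomogeneous 1 ∧ ℓ ≠ 0 ∧ ℓ ∈ x₀.asHomogeneousIdeal ∧
      ¬ Set.range ι ⊆ {y : Proj (homogeneousSubmodule (Fin (r + 1 + 1)) k) | ℓ ∈ y.asHomogeneousIdeal}) then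
        (Proj.map (fO ℓ h') (hfO' ℓ h')).ker else ⊥) = (Proj.map (fO ℓ h) (hfO' ℓ h)).ker := dif_pos h
  beta_reduce
  refine ⟨c ℓ h, j₁ ℓ h, fO ℓ h, hfO' ℓ h, hdef, hmap, LinearLetter.isHomogeneous_sum_C_mul_X_one (c ℓ h), hC, he, hker, ?_, ?_⟩
  · exact hdef ▸ ⟨h1, h2, h3, h4, h5⟩
  · exact hdef ▸ hle

end KeyForm

end Summit.ResolutionOfSingularities.ResolutionOfSingularities.Cruxes.EquisingularLiftNat.Sections

end
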